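import Mathlib
import Literature.Probability.Percolation.MinOpenCut
import Summits.CriticalPhenomena.PercolationContinuityZ3.Theorems.DefectDimension.Negative.AllOpenCutsets
import HarnessLib

/-!
# Crux `PercBudgetLadder.DefectDimension` (stmt-CriticalPhenomena-5250), line `chemical-tortuosity-packing` — stub `stub_packing`

Helper file for the crux skeleton `Cruxes/DefectDimension/Lines/chemical-tortuosity-packing.lean`
(lead prover-line-stmt-CriticalPhenomena-5250-0). Proves exactly the registered stub signature
`stub_packing`; lands with `--supports stmt-CriticalPhenomena-5250`.

## The statement (deterministic chemical-layer packing)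

For a lattice configuration `ω ⊆ E(ℤ³)` and `ℓ > 0`: if every walk of the open graph induced on
`B(2n) = box 3 (2n)` from a vertex of `B(n)` to a vertex of `∂ⁱⁿB(2n)` has length `≥ ℓ`, then
`ω ∈ budgetEvent n (3(4n+1)³/ℓ)`, i.e. some set of at most `3(4n+1)³/ℓ` edges is an open cutset of
the annulus `A(n,2n)` inside `B(2n)` (`MinCut(n,2n) ≤ 3(4n+1)³/ℓ`).

## The argument (BFS layers of the chemical distance)

Let `H` be the open graph induced on `B(2n)` and `d(v) = min_{x ∈ B(n)} dist_H(x, v) ∈ ℕ∞` the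
chemical distance from `B(n)`. Then `d = 0` on `B(n)`, `d(v) ≤ d(u) + 1` along every edge of `H`,
and `d ≥ L := ⌈ℓ⌉ ≥ 1` on `∂ⁱⁿB(2n)` (walk lengths are integers). For `j < L` the layer
`E_j = {open lattice edges {u,v} ⊆ B(2n) : d(u) = j, d(v) = j+1}` is an open cutset: along an open
walk from `B(n)` (`d ≤ j`) to `∂ⁱⁿB(2n)` (`d ≥ j+1`) the first vertex with `d > j` is entered from a
vertex with `d ≤ j`, and the one-step bound forces the levels to be exactly `j`, `j+1`
(`StubPacking.exists_levelEdge_of_walk`). The layers are pairwise disjoint (the unordered pair of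
levels `{j, j+1}` determines `j`) subsets of the lattice edges of `B(2n)`, of which there are at most
`3·#B(2n) = 3(4n+1)³` (every lattice edge inside the box is `{x, x + eᵢ}` with `x` in the box,
`StubPacking.card_edgesIn_box_le`). By pigeonhole the smallest of the `L` layers has at most
`3(4n+1)³/L ≤ 3(4n+1)³/ℓ` edges.

Degenerate cases need no separate treatment: for `n = 0` the hypothesis is false (the nil walk at
the origin), and a blocked annulus only makes layers empty.

Mathlib API used: `SimpleGraph.edist` (`edist_triangle`, `edist_eq_one_iff_adj`, `edist_self`),
`ENat.iInf_add`, `SimpleGraph.Walk` induction, `Finset.card_biUnion`, `Finset.exists_min_image`,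
`Nat.ceil`. Tree API: `mem_budgetEvent_iff`, `isOpenCutsetIn_iff_isEdgeCutsetIn_openGraph`,
`mem_edgesIn_iff`, `zdGraph_adj_iff`, `card_box`, `openGraph_adj`.
-/

noncomputable section

namespace Summit.CriticalPhenomena.PercolationContinuityZ3.Theorems

open MeasureTheory Filter Topology
open Literature.Probability.Percolation Literature.Probability.LatticeModels
open Summit.CriticalPhenomena.PercolationContinuityZ3.Theorems.DefectDimension.Negative (budgetEvent
  mem_budgetEvent_iff)

namespace StubPacking

/-! ### Generic graph lemmas: level functions along walks -/

/-- **Level-crossing edge.** If `d` grows by at most one along every edge of `H`, then every walk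
from a vertex with `d ≤ j` to a vertex with `d ≥ j + 1` traverses an edge `{u, v}` of the walk with
`d u = j` and `d v = j + 1` (the first vertex of the walk with `d > j` and its predecessor). -/
theorem exists_levelEdge_of_walk {W : Type*} {H : SimpleGraph W} (d : W → ℕ∞)
    (hd : ∀ u v, H.Adj u v → d v ≤ d u + 1) (j : ℕ) {a b : W} (p : H.Walk a b)
    (ha : d a ≤ j) (hb : (j : ℕ∞) + 1 ≤ d b) :
    ∃ u v : W, H.Adj u v ∧ s(u, v) ∈ p.edges ∧ d u = j ∧ d v = j + 1 := by
  induction p with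
  | nil =>
    have h : ((j + 1 : ℕ) : ℕ∞) ≤ (j : ℕ∞) := by push_cast; exact hb.trans ha
    exact absurd (Nat.cast_le.1 h) (by omega)
  | @cons a c b hadj p ih =>
    by_cases hc : d c ≤ j
    · obtain ⟨u, v, huv, he, hu, hv⟩ := ih hc hb
      exact ⟨u, v, huv, by simp [he], hu, hv⟩
    · obtain ⟨ka, hka⟩ : ∃ ka : ℕ, (ka : ℕ∞) = d a :=
        ENat.ne_top_iff_exists.1 (ne_top_of_le_ne_top (ENat.coe_ne_top j) ha)
      have h1 : d c ≤ d a + 1 := hd a c hadj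
      rw [← hka] at ha h1
      obtain ⟨kc, hkc⟩ : ∃ kc : ℕ, (kc : ℕ∞) = d c :=
        ENat.ne_top_iff_exists.1
          (ne_top_of_le_ne_top (by exact_mod_cast ENat.coe_ne_top (ka + 1)) h1)
      rw [← hkc] at hc h1
      have ha' : ka ≤ j := by exact_mod_cast ha
      have h1' : kc ≤ ka + 1 := by exact_mod_cast h1
      have hc' : ¬ kc ≤ j := by exact_mod_cast hc
      refine ⟨a, c, hadj, by simp, ?_, ?_⟩
      · rw [← hka]; exact_mod_cast (by omega : ka = j)
      · rw [← hkc]; exact_mod_cast (by omega : kc = j + 1)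

/-- One-step bound for distances from a family of sources: if `u ∼ v` then
`inf_i dist(x_i, v) ≤ inf_i dist(x_i, u) + 1`. -/
theorem iInf_edist_le_iInf_edist_add_one {W : Type*} {H : SimpleGraph W} {ι : Sort*}
    (x : ι → W) {u v : W} (h : H.Adj u v) :
    ⨅ i, H.edist (x i) v ≤ (⨅ i, H.edist (x i) u) + 1 := by
  rw [ENat.iInf_add]
  refine iInf_mono fun i => ?_
  calc H.edist (x i) v ≤ H.edist (x i) u + H.edist u v := SimpleGraph.edist_triangle
    _ = H.edist (x i) u + 1 := by rw [SimpleGraph.edist_eq_one_iff_adj.2 h]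

/-- **The chemical distance from a set as a level function.** If every walk of `H` from `A` to
`B` has length `≥ L`, then `d(v) = inf_{a ∈ A} dist_H(a, v)` vanishes on `A`, grows by at most one
along every edge, and is `≥ L` on `B` (`= ⊤` on vertices not reachable from `A`). -/
theorem exists_levelFunction {W : Type*} (H : SimpleGraph W) (A B : Set W) (L : ℕ)
    (hAB : ∀ a ∈ A, ∀ b ∈ B, ∀ p : H.Walk a b, L ≤ p.length) :
    ∃ d : W → ℕ∞, (∀ a ∈ A, d a = 0) ∧ (∀ u v, H.Adj u v → d v ≤ d u + 1) ∧
      ∀ b ∈ B, (L : ℕ∞) ≤ d b := by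
  refine ⟨fun v => ⨅ a : A, H.edist a v, ?_, ?_, ?_⟩
  · intro a ha
    exact nonpos_iff_eq_zero.1 ((iInf_le (fun a' : A => H.edist a' a) ⟨a, ha⟩).trans (by simp))
  · intro u v h
    exact iInf_edist_le_iInf_edist_add_one (fun a : A => (a : W)) h
  · intro b hb
    refine le_iInf fun a => ?_
    unfold SimpleGraph.edist
    exact le_iInf fun p => by exact_mod_cast hAB a a.2 b hb p

/-! ### Counting the lattice edges of a box -/

/-- `#edgesIn(B(2n)) ≤ 3·#B(2n) = 3(4n+1)³`: every lattice edge with both endpoints in the box is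
`{x, x + eᵢ}` for some `x` in the box and some direction `i : Fin 3`. -/
theorem card_edgesIn_box_le (n : ℕ) :
    (edgesIn (zdGraph 3) (box 3 (2 * n))).card ≤ 3 * (4 * n + 1) ^ 3 := by
  classical
  set f : Site 3 × Fin 3 → Sym2 (Site 3) := fun p => s(p.1, p.1 + Pi.single p.2 1) with hf
  have hsub : edgesIn (zdGraph 3) (box 3 (2 * n)) ⊆
      (box 3 (2 * n) ×ˢ (Finset.univ : Finset (Fin 3))).image f := by
    intro e he
    rw [mem_edgesIn_iff] at he
    obtain ⟨hE, hbox⟩ := he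
    revert hE hbox
    induction e using Sym2.ind with
    | h a b =>
      intro hE hbox
      rw [SimpleGraph.mem_edgeSet, zdGraph_adj_iff] at hE
      obtain ⟨i, h | h⟩ := hE
      · exact Finset.mem_image.2 ⟨(a, i), Finset.mem_product.2
          ⟨hbox a (Sym2.mem_mk_left a b), Finset.mem_univ i⟩, by rw [hf, h]⟩
      · refine Finset.mem_image.2 ⟨(b, i), Finset.mem_product.2
          ⟨hbox b (Sym2.mem_mk_right a b), Finset.mem_univ i⟩, ?_⟩
        rw [hf, h]
        exact Sym2.eq_swap
  calc (edgesIn (zdGraph 3) (box 3 (2 * n))).card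
      ≤ ((box 3 (2 * n) ×ˢ (Finset.univ : Finset (Fin 3))).image f).card :=
        Finset.card_le_card hsub
    _ ≤ (box 3 (2 * n) ×ˢ (Finset.univ : Finset (Fin 3))).card := Finset.card_image_le
    _ = 3 * (4 * n + 1) ^ 3 := by
        rw [Finset.card_product, card_box, Finset.card_univ, Fintype.card_fin]
        ring

end StubPacking

/-- **stub_packing (chemical-layer packing; deterministic).** For a lattice configuration
`ω ⊆ E(ℤ³)` and `ℓ > 0`: if every open walk inside `B(2n)` from `B(n)` to `∂ⁱⁿB(2n)` has length
`≥ ℓ`, then `ω ∈ budgetEvent n (3(4n+1)³/ℓ)` — the cheapest of the `⌈ℓ⌉` pairwise-disjoint BFS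
layers `E_j = {open {u,v} ⊆ B(2n) : d(u) = j, d(v) = j+1}` (`d` = chemical distance from `B(n)`
inside `B(2n)`), each an open cutset of `A(n,2n)` inside `B(2n)`, all contained in the `≤ 3(4n+1)³`
lattice edges of `B(2n)`, has at most `3(4n+1)³/⌈ℓ⌉ ≤ 3(4n+1)³/ℓ` edges. -/
theorem stub_packing :
    ∀ (n : ℕ) (ℓ : ℝ) (ω : BondConfig (Site 3)), ω ⊆ (zdGraph 3).edgeSet → 0 < ℓ →
      (∀ x y : ((box 3 (2 * n) : Finset (Site 3)) : Set (Site 3)),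
        (x : Site 3) ∈ box 3 n → (y : Site 3) ∈ innerBoundary (zdGraph 3) (box 3 (2 * n)) →
        ∀ w : ((openGraph ω).induce ((box 3 (2 * n) : Finset (Site 3)) : Set (Site 3))).Walk x y,
          ℓ ≤ (w.length : ℝ)) →
      ω ∈ budgetEvent n (3 * (4 * (n : ℝ) + 1) ^ 3 / ℓ) := by
  intro n ℓ ω hω hℓ hlen
  classical
  -- the chemical distance from `B(n)` inside `B(2n)` as a level function
  obtain ⟨d, hdA, hd, hdB⟩ := StubPacking.exists_levelFunction
    ((openGraph ω).induce ((box 3 (2 * n) : Finset (Site 3)) : Set (Site 3)))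
    {a | (a : Site 3) ∈ box 3 n} {b | (b : Site 3) ∈ innerBoundary (zdGraph 3) (box 3 (2 * n))}
    ⌈ℓ⌉₊ (fun a ha b hb p => Nat.ceil_le.2 (hlen a b ha hb p))
  set L : ℕ := ⌈ℓ⌉₊ with hL
  have hL1 : 0 < L := Nat.ceil_pos.2 hℓ
  -- the BFS layers
  set E : ℕ → Finset (Sym2 (Site 3)) := fun j => (edgesIn (zdGraph 3) (box 3 (2 * n))).filter
    fun e => e ∈ ω ∧ ∃ u v : ((box 3 (2 * n) : Finset (Site 3)) : Set (Site 3)),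
      e = s((u : Site 3), (v : Site 3)) ∧ d u = j ∧ d v = j + 1 with hE
  have hEmem : ∀ j e, e ∈ E j ↔ e ∈ edgesIn (zdGraph 3) (box 3 (2 * n)) ∧ e ∈ ω ∧
      ∃ u v : ((box 3 (2 * n) : Finset (Site 3)) : Set (Site 3)),
        e = s((u : Site 3), (v : Site 3)) ∧ d u = j ∧ d v = j + 1 := fun j e => by
    rw [hE, Finset.mem_filter]
  -- each layer `j < L` is an open cutset
  have hcut : ∀ j < L, IsOpenCutsetIn ((box 3 (2 * n) : Finset (Site 3)) : Set (Site 3)) ↑(box 3 n)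
      ↑(innerBoundary (zdGraph 3) (box 3 (2 * n))) ω ↑(E j) := by
    intro j hj
    rw [isOpenCutsetIn_iff_isEdgeCutsetIn_openGraph]
    intro a b ha hb p
    obtain ⟨u, v, huv, he, hu, hv⟩ := StubPacking.exists_levelEdge_of_walk d hd j p
      (by simp [hdA a ha]) (le_trans (by exact_mod_cast hj) (hdB b hb))
    refine ⟨s(u, v), he, ?_⟩
    have hω' : s((u : Site 3), (v : Site 3)) ∈ ω :=
      ((openGraph_adj ω _ _).1 (SimpleGraph.induce_adj.1 huv)).1
    rw [Sym2.map_mk, Finset.mem_coe, hEmem]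
    refine ⟨?_, hω', u, v, rfl, hu, hv⟩
    rw [mem_edgesIn_iff]
    refine ⟨hω hω', fun z hz => ?_⟩
    rcases Sym2.mem_iff.1 hz with rfl | rfl
    · exact u.2
    · exact v.2
  -- the layers are pairwise disjoint
  have hdisj : (↑(Finset.range L) : Set ℕ).PairwiseDisjoint E := by
    intro j _ j' _ hne
    rw [Function.onFun, Finset.disjoint_left]
    intro e he he'
    rw [hEmem] at he he'
    obtain ⟨-, -, u, v, rfl, hu, hv⟩ := he
    obtain ⟨-, -, u', v', heq, hu', hv'⟩ := he'
    apply hne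
    rcases Sym2.eq_iff.1 heq with ⟨h1, -⟩ | ⟨h1, h2⟩
    · have e1 : u = u' := Subtype.ext h1
      subst e1
      exact_mod_cast hu.symm.trans hu'
    · have e1 : u = v' := Subtype.ext h1
      have e2 : v = u' := Subtype.ext h2
      subst e1 e2
      have h3 : j = j' + 1 := by exact_mod_cast hu.symm.trans hv'
      have h4 : j + 1 = j' := by exact_mod_cast hv.symm.trans hu'
      omega
  -- counting: the layers are packed into the lattice edges of the box
  have hsum : ∑ j ∈ Finset.range L, (E j).card ≤ 3 * (4 * n + 1) ^ 3 := by
    rw [← Finset.card_biUnion hdisj]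
    refine le_trans (Finset.card_le_card fun e he => ?_) (StubPacking.card_edgesIn_box_le n)
    obtain ⟨j, -, hj⟩ := Finset.mem_biUnion.1 he
    exact ((hEmem j e).1 hj).1
  -- pigeonhole: the cheapest layer
  obtain ⟨j₀, hj₀, hmin⟩ := Finset.exists_min_image (Finset.range L) (fun j => (E j).card)
    ⟨0, Finset.mem_range.2 hL1⟩
  have hLm : L * (E j₀).card ≤ 3 * (4 * n + 1) ^ 3 :=
    calc L * (E j₀).card = ∑ _j ∈ Finset.range L, (E j₀).card := by
          rw [Finset.sum_const, Finset.card_range, smul_eq_mul]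
      _ ≤ ∑ j ∈ Finset.range L, (E j).card := Finset.sum_le_sum fun j hj => hmin j hj
      _ ≤ 3 * (4 * n + 1) ^ 3 := hsum
  rw [mem_budgetEvent_iff]
  refine ⟨E j₀, ?_, hcut j₀ (Finset.mem_range.1 hj₀)⟩
  have hLm' : (L : ℝ) * (E j₀).card ≤ 3 * (4 * n + 1) ^ 3 := by exact_mod_cast hLm
  rw [le_div_iff₀ hℓ]
  calc ((E j₀).card : ℝ) * ℓ ≤ (E j₀).card * L :=
        mul_le_mul_of_nonneg_left (Nat.le_ceil ℓ) (Nat.cast_nonneg _)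
    _ = L * (E j₀).card := mul_comm _ _
    _ ≤ 3 * (4 * (n : ℝ) + 1) ^ 3 := hLm'

end Summit.CriticalPhenomena.PercolationContinuityZ3.Theorems

end
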